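import Literature.NumberTheory.EllipticCurves.SqrtTwoTwistPointCount
import HarnessLib

/-!
# Brewer's character sum `Σ ((x + 2)(x² − 2)/p) = 2c` (`p = c² + 2d²`) and the split Euler factors of the `j = 8000` family

Topic `Literature/NumberTheory/EllipticCurves`, namespace `Literature.NumberTheory.EllipticCurves.SqrtTwoTwist` (sequel to
`SqrtTwoTwistPointCount`).  ONE named fact (`Brewer1961_characterSum`) and its first consequences.

For `B_n : y² = x³ + 4n x² + 2n² x` (CM by `ℤ[√-2]`, `j = 8000`) and a prime `p ∤ 2n`, `a_p(B_n) = −Σ_x χ(x³ + 4nx² + 2n²x)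
= −χ(n) χ(−1) · B(𝔽_p)` with BREWER'S CHARACTER SUM `B(F) = Σ_{x ∈ F} χ((x + 2)(x² − 2))` (`SqrtTwoTwistPointCount`:
`sum_quadraticChar_twist`, `sum_quadraticChar_B_eq_brewer`).  Brewer's theorem (Trans. AMS 99 (1961); Leonard–Williams,
RMJM 5 (1975), Theorem p. 301): `B = 0` if `p ≢ 1, 3 (mod 8)` (PROVED in `SqrtTwoTwistPointCount`, Williams 1978), and
**`B = 2c` if `p = c² + 2d²`, `c ≡ (−1)^{k+1} (mod 4)`, `p = 8k + 1` or `8k + 3`** — the named fact of this file, whose printed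
proofs are cyclotomic (Jacobi sums of order `8` over `𝔽_p` for `p ≡ 1 (8)`; Eisenstein sums over `𝔽_{p²}` for `p ≡ 3 (8)`) or go
through complex multiplication (Rajwade 1968).  Consequence: **`a_p(B_n) = −(−n/p) · 2c`** at every prime `p ≡ 1, 3 (mod 8)`,
`p ∤ n` (`lFunction_B_apply_prime_of_brewer`) — Deuring's `a_p = ψ(𝔭) + ψ(𝔭̄)` for `j = 8000` WITH ITS SIGN (Rajwade;
Silverberg 2010 Thm. 2.7: `π ≡ 1, 3, 1 ± √-2, 3 ± √-2, 5 + 2√-2, 7 + 2√-2 (mod 4√-2)`), which the tree's unsigned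
`Deuring1941_frobeniusTrace_eq_add_conj_holds` does not give.  Nothing about BSD is proved here.

## References
* B. W. Brewer, *On certain character sums*, Trans. Amer. Math. Soc. 99 (1961), 241–245. [Brewer1961]
* P. A. Leonard, K. S. Williams, *Jacobi sums and a theorem of Brewer*, Rocky Mountain J. Math. 5 (1975), 301–308. [LeonardWilliams1975]
* A. R. Rajwade, *Arithmetic on curves with complex multiplication by √−2*, Proc. Cambridge Philos. Soc. 64 (1968), 659–672. [Rajwade1968]
* A. Silverberg, *Group order formulas for reductions of CM elliptic curves*, Contemp. Math. 521 (2010), Thm. 2.7. [Silverberg2010]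
* K. S. Williams, *Note on Brewer's character sum*, Proc. Amer. Math. Soc. 71 (1978), 153–154. [Williams1978]

## Mathlib / tree search
Tree: `SqrtTwoTwist.{sum_quadraticChar_twist, sum_quadraticChar_B_eq_brewer, sum_quadraticChar_brewer_eq_zero,
natCard_point_eq_card_add_one_add_sum, map_int, isElliptic_B_zmod, not_dvd_Δ_B_int}` (`SqrtTwoTwistPointCount`),
`Automorphic.lFunction_map_apply_prime_of_not_dvd`.  No Jacobi sums of order `8` in Mathlib or the tree
(`lean search 'Brewer|x \^ 2 - 2\)\)'`).
-/

noncomputable section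

open Finset

namespace Literature.NumberTheory.EllipticCurves

namespace SqrtTwoTwist

section Brewer

variable (F : Type*) [Field F] [Fintype F] [DecidableEq F]

/-- **Brewer's character sum** `B(F) = Σ_{x ∈ F} χ((x + 2)(x² − 2))` of a finite field `F` (`χ` the quadratic character; for
`F = ℤ/p` this is Brewer's `B = Σ_{x=0}^{p−1} ((x + 2)(x² − 2)/p)`, Leonard–Williams (1.1)).
[cite: Brewer1961, §1] [cite: LeonardWilliams1975, (1.1)] -/
def brewerSum : ℤ := ∑ x : F, quadraticChar F ((x + 2) * (x ^ 2 - 2))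

variable {F}

/-- `B(F) = 0` when `χ(−2) = −1` — Brewer's first clause (`p ≡ 5, 7 (mod 8)`), a THEOREM (Williams' proof,
`SqrtTwoTwistPointCount`). [cite: Brewer1961, Theorem 2] [cite: Williams1978, Abstract] -/
theorem brewerSum_eq_zero (hF : ringChar F ≠ 2) (h2 : quadraticChar F (-2) = -1) : brewerSum F = 0 :=
  sum_quadraticChar_brewer_eq_zero hF h2

/-- `Σ_x χ(x³ + 4x² + 2x) = χ(−1) · B(F)`. [cite: Williams1978, p. 153 (x ↦ x − 2)] -/
theorem sum_quadraticChar_B_eq_brewerSum :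
    ∑ x : F, quadraticChar F (x ^ 3 + 4 * x ^ 2 + 2 * x) = quadraticChar F (-1) * brewerSum F :=
  sum_quadraticChar_B_eq_brewer

end Brewer

/-- **Brewer's theorem on the character sum `Σ_{x=0}^{p−1} ((x + 2)(x² − 2)/p)`, second clause** (named fact; Brewer, Trans.
AMS 99 (1961); in the form printed by Leonard–Williams, Rocky Mountain J. Math. 5 (1975), p. 301): «It is well known that
`p = c² + 2d²` if and only if `p = 8k + 1` or `p = 8k + 3`, and that in these cases `c` is unique if we require
`c ≡ (−1)^{k+1} (mod 4)`. … THEOREM. `B = 0` if `p ≠ c² + 2d²`; `B = 2c` if `p = c² + 2d²` and `c ≡ (−1)^{k+1} (mod 4)`»,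
where `B = Σ_{x=0}^{p−1} ((x + 2)(x² − 2)/p)` (Legendre symbol).  Here: the second clause, for an odd prime `p ≡ 1, 3 (mod 8)`
(`k = ⌊p/8⌋`; `(−1)^{k+1} ≡ 3 (mod 4)` for `k` even, `≡ 1` for `k` odd), with the Legendre symbol written as Mathlib's quadratic
character of `ℤ/p` (`legendreSym p a = quadraticChar (ZMod p) a`) inside `brewerSum (ZMod p)`.  The first clause is the theorem
`brewerSum_eq_zero`.  Printed proofs: Brewer 1961 and Whiteman 1963 (cyclotomy, Jacobsthal sums), Rajwade 1968 (complex
multiplication by `√-2` on `y² = x(x² − 4x + 2)`), Leonard–Williams 1975 (Jacobi sums of order `8` over `𝔽_p` for `p ≡ 1 (8)`: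
Lemmas 4.1–4.2 and (5.3); Eisenstein sums over `𝔽_{p²}` for `p ≡ 3 (8)`: Lemmas 4.3–4.4 and (5.4)–(5.8)).  Not in Mathlib or the
tree.  Checked numerically for every `p < 700` (seat folder `kit/check_brewer.py`).
[cite: LeonardWilliams1975, Theorem (p. 301)] [cite: Brewer1961, Theorem 2] -/
def Brewer1961_characterSum : Prop :=
  ∀ (p : ℕ) [Fact p.Prime], (p % 8 = 1 ∨ p % 8 = 3) → ∀ (c d : ℤ), (p : ℤ) = c ^ 2 + 2 * d ^ 2 →
    c % 4 = (if (p / 8) % 2 = 0 then 3 else 1) → brewerSum (ZMod p) = 2 * c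

/-- **`a_p(B_n) = −(−n/p) · 2c` at a prime `p ≡ 1, 3 (mod 8)`, `p ∤ n`, `p = c² + 2d²`, `c ≡ (−1)^{⌊p/8⌋+1} (mod 4)`** — on the
`ℤ`-model: `a_p = −Σ_x χ(x³ + 4nx² + 2n²x) = −χ(n) χ(−1) B = −(−n/p) · 2c`, from the twist law, `sum_quadraticChar_B_eq_brewer`
and Brewer's theorem (hypothesis `hB`).  For `n = −a` this is Rajwade's `#E(𝔽_p) = p + 1 − (a/p)(π + π̄)`,
`π = −c ± d√-2 ≡ 1, 3, 1 ± √-2, 3 ± √-2, 5 + 2√-2, 7 + 2√-2 (mod 4√-2)`.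
[cite: LeonardWilliams1975, Theorem (p. 301)] [cite: Rajwade1968, Theorem 1] [cite: Silverberg2010, Thm. 2.7] -/
theorem frobeniusTrace_B_of_brewer (hB : Brewer1961_characterSum) {p : ℕ} [Fact p.Prime]
    (hp8 : p % 8 = 1 ∨ p % 8 = 3) {n : ℤ} (hpn : ¬ (p : ℤ) ∣ n) {c d : ℤ} (hcd : (p : ℤ) = c ^ 2 + 2 * d ^ 2)
    (hc4 : c % 4 = (if (p / 8) % 2 = 0 then 3 else 1)) :
    Literature.NumberTheory.Automorphic.frobeniusTrace (⟨0, 4 * n, 0, 2 * n ^ 2, 0⟩ : WeierstrassCurve ℤ) p =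
      -(quadraticChar (ZMod p) (-n) * (2 * c)) := by
  have hp : p.Prime := Fact.out
  have hp2 : p ≠ 2 := by rintro rfl; norm_num at hp8
  have hchar : ringChar (ZMod p) ≠ 2 := by rwa [ZMod.ringChar_zmod_n]
  have h2n : ¬ (p : ℤ) ∣ 2 * n := by
    intro h
    rcases (Nat.prime_iff_prime_int.mp hp).dvd_or_dvd h with h | h
    · exact hp2 ((Nat.prime_dvd_prime_iff_eq hp Nat.prime_two).mp (by exact_mod_cast h))
    · exact hpn h
  have hn0 : ((n : ℤ) : ZMod p) ≠ 0 := fun h ↦ hpn ((ZMod.intCast_zmod_eq_zero_iff_dvd n p).mp h)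
  haveI hE := isElliptic_B_zmod (p := p) h2n
  rw [map_int] at hE
  unfold Literature.NumberTheory.Automorphic.frobeniusTrace Literature.NumberTheory.Automorphic.numPointsMod
  rw [map_int, natCard_point_eq_card_add_one_add_sum hchar _ _ hE.isUnit.ne_zero, ZMod.card,
    sum_quadraticChar_twist 4 2 hn0, sum_quadraticChar_B_eq_brewerSum, hB p hp8 c d hcd hc4]
  have hneg : quadraticChar (ZMod p) (-(n : ZMod p)) = quadraticChar (ZMod p) n * quadraticChar (ZMod p) (-1) := by
    rw [← map_mul, mul_neg_one]
  rw [hneg]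
  ring

/-- ★ **`a_p(B_n) = −(−n/p) · 2c`** for Mathlib's `WeierstrassCurve.LFunction` of `B_n / ℚ` at a prime `p ≡ 1, 3 (mod 8)` not
dividing `n`, where `p = c² + 2d²`, `c ≡ (−1)^{⌊p/8⌋+1} (mod 4)` — modulo Brewer's theorem `hB`; the split half of Deuring's
theorem for `j = 8000` WITH its sign (`ψ(π) + ψ(π̄)` for the Grössencharacter of `B_n`).
[cite: LeonardWilliams1975, Theorem (p. 301)] [cite: Rajwade1968, Theorem 1] [cite: Silverberg2010, Thm. 2.7] -/
theorem lFunction_B_apply_prime_of_brewer (hB : Brewer1961_characterSum) {p : ℕ} [Fact p.Prime]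
    (hp8 : p % 8 = 1 ∨ p % 8 = 3) {n : ℤ} (hpn : ¬ (p : ℤ) ∣ n) {c d : ℤ} (hcd : (p : ℤ) = c ^ 2 + 2 * d ^ 2)
    (hc4 : c % 4 = (if (p / 8) % 2 = 0 then 3 else 1)) :
    (⟨0, 4 * (n : ℚ), 0, 2 * (n : ℚ) ^ 2, 0⟩ : WeierstrassCurve ℚ).LFunction p = -(legendreSym p (-n) * (2 * c)) := by
  have hp : p.Prime := Fact.out
  have hp2 : p ≠ 2 := by rintro rfl; norm_num at hp8
  have h2n : ¬ (p : ℤ) ∣ 2 * n := by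
    intro h
    rcases (Nat.prime_iff_prime_int.mp hp).dvd_or_dvd h with h | h
    · exact hp2 ((Nat.prime_dvd_prime_iff_eq hp Nat.prime_two).mp (by exact_mod_cast h))
    · exact hpn h
  rw [← map_int_rat, Literature.NumberTheory.Automorphic.lFunction_map_apply_prime_of_not_dvd _ hp
    (not_dvd_Δ_B_int hp h2n), frobeniusTrace_B_of_brewer hB hp8 hpn hcd hc4, legendreSym]
  push_cast
  ring

end SqrtTwoTwist

end Literature.NumberTheory.EllipticCurves

end
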